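import Literature.Computability.MetaComplexity.AvgCaseDerandomizationProofs
import Literature.Computability.MetaComplexity.AvgCaseNEUniform
import Literature.Computability.Complexity.TimeHierarchyAE
import Literature.Computability.Complexity.CircuitLowerBoundsIW
import HarnessLib

/-!
# Buhrman–Fortnow–Pavan, Thm. 3.1: the proof skeleton, proved — the fact reduced to Lemma 3.7 and IW97 Thm. 1

Third proof file of `AvgCaseDerandomization.lean` (the named fact
`BuhrmanFortnowPavan2004_PromiseBPP'_subset_PromiseP`: `DistNP ⊆ AvgP ⟹ Promise-BPP = Promise-P`,
BFP Thm. 3.1 in the promise form used by Hirahara, Cor. 4.23). The printed proof (BFP 2005, p. 6):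

> "Suppose that there exists a language `A` in `E` and an `ε` such that for almost every `n`, `Aₙ`
> has circuit complexity at least `2^{εn}`, then by Theorem 3.2 [IW97] we have that pseudorandom
> generators exist and we are done. We will show that indeed there exists such a hard language in
> `E`. By contradiction assume that for every `ε > 0` and set `A ∈ E` there exist infinitely many `n`
> such that `Aₙ` has circuits of size `2^{εn}`. For some `d` to be chosen later, let `A` be a set in
> `DTIME(2^{dn})` such that for every Turing machine `M` using time bounded by `2^{(d-1)n}`, and for
> all but a finite number of `n`, `M` fails to compute `A` correctly on some input of length `n`. …
> By Lemma 3.7, we have that there is a language `B` in `NTIME(2ⁿ)` such that `Bₙ = Aₙ` for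
> infinitely many `n`. Since `NP` is easy on average, by Theorem 3.5, `E = NE`. [IKW02] showed that
> if `E = NE`, then there exists a fixed constant `e` such that `NTIME(2ⁿ) ⊆ DTIME(2^{en})`. Thus `B`
> is in `DTIME(2^{en})`. Choosing `d = e + 1` gives a contradiction with the construction of `A`."

Every step of this skeleton is now a theorem of the tree — the derandomization
(`BuhrmanFortnowPavan2004_PromiseBPP'_subset_PromiseP_of_hardE`, `AvgCaseDerandomizationProofs.lean`,
from `PRGDerandomizationPromise.lean`), Thm. 3.5 and the uniform collapse
(`exists_NTIME_two_pow_subset_DTIME_of_DistNP_subset_AvgP`, `AvgCaseNE.lean` /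
`AvgCaseNEUniform.lean`), the diagonal language (`exists_ae_hard_mem_E`, `TimeHierarchyAE.lean`) —
EXCEPT its two genuinely hard published ingredients, which this file carries as explicit hypotheses
(not named facts, D-0026):

* `h37` — **BFP Lemma 3.7** (p. 5: "Assume `NP` is easy on average. If for all `ε > 0`, `E`
  infinitely often has circuits of size `2^{εn}` then for all `A` in `E` and `ε > 0` there is a
  language `L` in `NTIME(2^{εn})` such that for infinitely many `n`, `Aₙ = Lₙ`"; its proof is Lemma
  3.4 — Babai–Fortnow–Levin–Szegedy / Polishchuk–Spielman probabilistically checkable proofs for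
  `E`-computations, of length `t^{1+ε}` and verifiable in polylogarithmic time, turned into
  `2^{εn}`-time Merlin–Arthur protocols by the infinitely-often small circuits — followed by the
  Köbler–Schuler derandomisation of Merlin–Arthur protocols from a certified hard truth table under
  the average-case hypothesis), in the weakest form the skeleton consumes: `L ∈ NTIME(2ⁿ)`;
* `hamp` — **Impagliazzo–Wigderson 1997, Thm. 1** (hardness amplification inside `E`), in the shape
  of `impagliazzo_wigderson_of_hardnessAmplification` (`CircuitLowerBoundsIW.lean`), the remaining
  obligation of the tree's named fact `impagliazzo_wigderson` as well.

Main result: **`BuhrmanFortnowPavan2004_PromiseBPP'_subset_PromiseP_of_lemma37_of_hamp`**, and the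
intermediate **`exists_hard_E_of_DistNP_subset_AvgP_of_lemma37`** (the body of the printed proof:
under `DistNP ⊆ AvgP` and Lemma 3.7, some `L ∈ E` needs circuits of size `2^{εn}` at all large `n`).

## Update (2026-08-15, second revision): `hamp` discharged

Impagliazzo–Wigderson's Thm. 1 is now a theorem of the tree (the chain behind
`impagliazzo_wigderson_holds`, `CircuitLowerBoundsIW.lean`: `HardLangM.exists_mildHard_E`, then
`IWStrong.avgHard_strongLang` with `IWStrongM.strongLang_mem_E`); it is repackaged here in the shape of
`hamp` as `exists_avgHard_E_of_hard_E`, so that the named fact is reduced to BFP's Lemma 3.7 ALONE: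
**`BuhrmanFortnowPavan2004_PromiseBPP'_subset_PromiseP_of_lemma37`**.

## References

* H. Buhrman, L. Fortnow, A. Pavan, *Some results on derandomization*, Theory Comput. Syst. 38
  (2005) 211–227, Thm. 3.1 and its proof, Lemma 3.4, Thm. 3.5, Lemma 3.7 (authors' version pp. 4–6,
  text checked) [BuhrmanFortnowPavan2004].
* R. Impagliazzo, A. Wigderson, *P = BPP if E requires exponential circuits*, STOC 1997, Thm. 1
  [ImpagliazzoWigderson1997].
* R. Impagliazzo, V. Kabanets, A. Wigderson, *In search of an easy witness*, JCSS 65 (2002).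
-/

namespace Literature.Computability.MetaComplexity

open _root_.Computability Complexity Filter

/-- **The body of BFP's proof of Thm. 3.1, from Lemma 3.7**: under `DistNP ⊆ AvgP`, if Lemma 3.7
holds then some language in `E` needs circuits of size `2^{εn}` at all large lengths `n`. By
contradiction: otherwise every `A ∈ E` has `2^{εn}`-size circuits infinitely often for every
`ε > 0`; take `e` with `NTIME(2ⁿ) ⊆ DTIME(2^{en})` (`exists_NTIME_two_pow_subset_DTIME_of_DistNP_subset_AvgP`)
and the language `A ∈ E` that every `DTIME(2^{en})` language misses at every large length
(`exists_ae_hard_mem_E`); Lemma 3.7 gives `B ∈ NTIME(2ⁿ) ⊆ DTIME(2^{en})` agreeing with `A` at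
infinitely many lengths — a contradiction. [cite: BuhrmanFortnowPavan2004, Thm. 3.1 (proof) and Lemma 3.7] -/
theorem exists_hard_E_of_DistNP_subset_AvgP_of_lemma37
    (h37 : DistNP ⊆ AvgP →
      (∀ A ∈ E, ∀ ε : ℝ, 0 < ε → ∃ᶠ n : ℕ in atTop, (A.circuitSize n : ℝ) ≤ (2 : ℝ) ^ (ε * n)) →
      ∀ A ∈ E, ∃ B ∈ NTIME (fun n => 2 ^ n), ∃ᶠ n : ℕ in atTop,
        ∀ x : List Bool, x.length = n → (x ∈ A ↔ x ∈ B))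
    (hD : DistNP ⊆ AvgP) :
    ∃ L ∈ E, ∃ ε : ℝ, 0 < ε ∧ ∀ᶠ n : ℕ in atTop, (2 : ℝ) ^ (ε * n) ≤ (L.circuitSize n : ℝ) := by
  by_contra hno
  -- every language in `E` has small circuits infinitely often
  have hio : ∀ A ∈ E, ∀ ε : ℝ, 0 < ε → ∃ᶠ n : ℕ in atTop, (A.circuitSize n : ℝ) ≤ (2 : ℝ) ^ (ε * n) := by
    intro A hA ε hε
    by_contra hfr
    refine hno ⟨A, hA, ε, hε, ?_⟩
    exact (Filter.not_frequently.1 hfr).mono fun n hn => (not_le.1 hn).le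
  obtain ⟨e, he⟩ := exists_NTIME_two_pow_subset_DTIME_of_DistNP_subset_AvgP hD
  obtain ⟨A, hA, hhard⟩ := exists_ae_hard_mem_E e
  obtain ⟨B, hB, hagree⟩ := h37 hD hio A hA
  obtain ⟨n₀, hn₀⟩ := hhard B (he hB)
  have hev : ∀ᶠ n : ℕ in atTop, ∃ x : List Bool, x.length = n ∧ (x ∈ B ↔ x ∉ A) :=
    Filter.eventually_atTop.2 ⟨n₀, hn₀⟩
  obtain ⟨n, hag, x, hx, hdis⟩ := (hagree.and_eventually hev).exists
  have h1 := hag x hx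
  tauto

/-- **Buhrman–Fortnow–Pavan, Thm. 3.1 (promise form) from Lemma 3.7 and Impagliazzo–Wigderson's
hardness amplification**: the named fact `BuhrmanFortnowPavan2004_PromiseBPP'_subset_PromiseP`
follows from BFP's Lemma 3.7 (`h37`, the probabilistically-checkable-proofs + Köbler–Schuler step,
stated in the weakest form consumed) and IW97 Thm. 1 (`hamp`, shape of
`impagliazzo_wigderson_of_hardnessAmplification`); everything else of the printed proof is proved in
the tree (`exists_hard_E_of_DistNP_subset_AvgP_of_lemma37`,
`BuhrmanFortnowPavan2004_PromiseBPP'_subset_PromiseP_of_hardE`).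
[cite: BuhrmanFortnowPavan2004, Thm. 3.1 (proof), Lemma 3.7] [cite: ImpagliazzoWigderson1997, Thms. 1–2] -/
theorem BuhrmanFortnowPavan2004_PromiseBPP'_subset_PromiseP_of_lemma37_of_hamp
    (h37 : DistNP ⊆ AvgP →
      (∀ A ∈ E, ∀ ε : ℝ, 0 < ε → ∃ᶠ n : ℕ in atTop, (A.circuitSize n : ℝ) ≤ (2 : ℝ) ^ (ε * n)) →
      ∀ A ∈ E, ∃ B ∈ NTIME (fun n => 2 ^ n), ∃ᶠ n : ℕ in atTop,
        ∀ x : List Bool, x.length = n → (x ∈ A ↔ x ∈ B))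
    (hamp : (∃ L ∈ E, ∃ ε : ℝ, 0 < ε ∧ ∀ᶠ n : ℕ in atTop, (2 : ℝ) ^ (ε * n) ≤ (L.circuitSize n : ℝ)) →
      ∃ L' ∈ E, ∃ ε' : ℝ, 0 < ε' ∧
        ∀ᶠ n : ℕ in atTop, AvgHardAtLeast (L'.sliceFn n) ((2 : ℝ) ^ (ε' * n))) :
    BuhrmanFortnowPavan2004_PromiseBPP'_subset_PromiseP :=
  BuhrmanFortnowPavan2004_PromiseBPP'_subset_PromiseP_of_hardE
    (exists_hard_E_of_DistNP_subset_AvgP_of_lemma37 h37) hamp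


/-- **Impagliazzo–Wigderson 1997, Thm. 1 (hardness amplification inside `E`)**, in the shape of the
hypothesis `hamp` above: if some `L ∈ E` needs circuits of size `2^{εn}` at all large lengths, then some
`L' ∈ E` is `2^{ε'n}`-hard on average at all large lengths. This is the chain proved in the tree for
`impagliazzo_wigderson_holds` (`CircuitLowerBoundsIW.lean`): worst-case to mild average-case hardness
(`HardLangM.exists_mildHard_E`, Arora–Barak Thm. 19.21), then mild to strong
(`IWStrong.avgHard_strongLang`, `IWStrongM.strongLang_mem_E`, with `q = ⌈64/ε₁⌉₊ + 1`), repackaged as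
a standalone implication. [cite: ImpagliazzoWigderson1997, Thm. 1] [cite: AroraBarakCC2009, Thm. 19.21 and Thm. 19.27] -/
theorem exists_avgHard_E_of_hard_E
    (hE : ∃ L ∈ E, ∃ ε : ℝ, 0 < ε ∧ ∀ᶠ n : ℕ in atTop, (2 : ℝ) ^ (ε * n) ≤ (L.circuitSize n : ℝ)) :
    ∃ L' ∈ E, ∃ ε' : ℝ, 0 < ε' ∧
      ∀ᶠ n : ℕ in atTop, AvgHardAtLeast (L'.sliceFn n) ((2 : ℝ) ^ (ε' * n)) := by
  obtain ⟨L₁, hL₁, ε₁, hε₁, hmild⟩ := HardLangM.exists_mildHard_E hE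
  have hq1 : 1 ≤ ⌈64 / ε₁⌉₊ + 1 := Nat.le_add_left 1 _
  have hqε : (64 : ℝ) ≤ ((⌈64 / ε₁⌉₊ + 1 : ℕ) : ℝ) * ε₁ := by
    have h1 : 64 / ε₁ ≤ (⌈64 / ε₁⌉₊ : ℝ) := Nat.le_ceil _
    have h2 : 64 / ε₁ * ε₁ = 64 := div_mul_cancel₀ 64 hε₁.ne'
    push_cast
    nlinarith
  exact ⟨Literature.Computability.Complexity.IWStrong.strongLang (⌈64 / ε₁⌉₊ + 1) L₁,
    Literature.Computability.Complexity.IWStrongM.strongLang_mem_E _ hq1 hL₁,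
    Literature.Computability.Complexity.IWStrong.epsOf (⌈64 / ε₁⌉₊ + 1),
    Literature.Computability.Complexity.IWStrong.epsOf_pos _,
    Literature.Computability.Complexity.IWStrong.avgHard_strongLang _ L₁ hq1 hqε hmild⟩

/-- **Buhrman–Fortnow–Pavan, Thm. 3.1 (promise form) from Lemma 3.7 alone**: with IW97 Thm. 1 proved
(`exists_avgHard_E_of_hard_E`), the named fact `BuhrmanFortnowPavan2004_PromiseBPP'_subset_PromiseP`
is reduced to BFP's Lemma 3.7 (`h37`: under `DistNP ⊆ AvgP`, if every language in `E` has
`2^{εn}`-size circuits infinitely often for every `ε > 0`, then every `A ∈ E` agrees with some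
`B ∈ NTIME(2ⁿ)` at infinitely many lengths — the BFLS/PS probabilistically-checkable-proofs step
(Lemma 3.4) followed by the Köbler–Schuler derandomisation), the one remaining proof obligation of its
discharge. [cite: BuhrmanFortnowPavan2004, Thm. 3.1 (proof), Lemma 3.4, Lemma 3.7]
[cite: ImpagliazzoWigderson1997, Thms. 1–2] -/
theorem BuhrmanFortnowPavan2004_PromiseBPP'_subset_PromiseP_of_lemma37
    (h37 : DistNP ⊆ AvgP →
      (∀ A ∈ E, ∀ ε : ℝ, 0 < ε → ∃ᶠ n : ℕ in atTop, (A.circuitSize n : ℝ) ≤ (2 : ℝ) ^ (ε * n)) →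
      ∀ A ∈ E, ∃ B ∈ NTIME (fun n => 2 ^ n), ∃ᶠ n : ℕ in atTop,
        ∀ x : List Bool, x.length = n → (x ∈ A ↔ x ∈ B)) :
    BuhrmanFortnowPavan2004_PromiseBPP'_subset_PromiseP :=
  BuhrmanFortnowPavan2004_PromiseBPP'_subset_PromiseP_of_lemma37_of_hamp h37 exists_avgHard_E_of_hard_E

end Literature.Computability.MetaComplexity
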